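import Literature.AlgebraicGeometry.HodgeTheory.DivisorLefschetzGroup
import Literature.AlgebraicGeometry.HodgeTheory.WeilClassesFieldDecomposableIffLefschetzGroup
import HarnessLib

/-!
# `W_F` decomposable ⟺ `G_div(X)` acts as the identity on `W_F` ⟺ `G_div(X) ⊆ Sl_F(V_X)`, for Moonen–Zarhin's OWN group
# `G_div(X) = Gl_B(V) ∩ Sp(V, φ)`; and Lemma (3) «`(⊕ᵢ ⋀ⁱ V_X)^{G_div(X)} = 𝒟•(X)`» in every degree (PROVED on the carrier)

Layer `Literature/AlgebraicGeometry/HodgeTheory`; THEOREMS ONLY (no definition, no named fact; D-0026 net debt 0).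
Junction of `HodgeTheory/DivisorLefschetzGroup` (the print's group `G_div(X)(ℂ) = divisorLefschetzGroup A h`, which FIXES
`𝒟•(X) ⊗ ℂ`, and `S(A)(h)(ℂ) ≤ G_div(X)(ℂ)`) with `HodgeTheory/WeilClassesFieldDecomposableIffLefschetzGroup` (the same
equivalences for Milne's SMALLER group `S(A)(h)(ℂ) = unitaryCentralizerGroup A h`, resting on the tree's THEOREM
`Milne1999.mem_divisorClassesSpan_of_forall_mem_unitaryCentralizerGroup` = Milne 1999 Thm. 3.2 / Cor. 4.5 over `ℂ`) and
`HodgeTheory/WeilClassesFieldFLinear` (Lemma (2) for an arbitrary multiplicative pair).  The sandwich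
`S(A)(h)(ℂ) ≤ G_div(X)(ℂ) ≤ Stab(𝒟•)` makes every statement of the former file hold VERBATIM for the print's group — but
`G_div(X)` need NOT commute with `F` (it centralizes only `B`), so here «`G_div(X) ⊆ Gl_F(V_X)`» is a genuine condition,
which is the point of the print's case distinction («`F ⊆ B`»).

## The print

B. J. J. Moonen, Yu. G. Zarhin, *Weil classes on abelian varieties*, J. reine angew. Math. **496** (1998) =
arXiv:alg-geom/9612017 [MoonenZarhin1998WeilClasses] (held text `paper:arxiv-alg-geom_9612017`). §1 Lemma (3) (chunk
p0003 L4–L5): «`End(V_X)^{G_div(X)} = B`; `(⋀² V_X)^{G_div(X)} = ℬ¹(X)`, and `(⊕ᵢ ⋀ⁱ V_X)^{G_div(X)} = 𝒟•(X)`.» Proof of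
Criterion (2) (chunk p0003 L62–L70): «We claim that, in these cases, `G_div(X)` acts as the identity on `W_F` if and
only if `F ⊆ B`. In the “only if” direction, this follows from Lemmas (2) and (3). Conversely, suppose that `F ⊆ B`,
so that `G_div(X) ⊆ Gl_F(V_X)`. In the cases we are considering, the group `G_div(X)` is connected and semi-simple, so
`G_div(X) ⊆ Sl_F(V_X)`, hence `G_div(X)` acts trivially on `W_F`.»

## What is proved (carriers as in the lane: `F = ℚ(φ)`, `P(φ) = 0` with `P ∈ ℤ[T]` monic irreducible of degree `e`,
`e · 2m = 2 dim A`, `W_F ⊗ ℂ = weilClassesField A φ P (2m)`, `𝒟ᵐ ⊗ ℂ = divisorClassesSpan A.X (dim A) m`,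
`G_div(X)(ℂ) = divisorLefschetzGroup A h` for ANY `h ∈ B¹(A) ⊗ ℂ` with `Q_h` non-degenerate, `⋀^{2m}u = exteriorPullback`,
`det(u | V_ρ) = VanGeemen1994.detOnEigenspace`)

* §1 LEMMA (3), THIRD CLAUSE, EVERY DEGREE: **`mem_divisorClassesSpan_iff_forall_mem_divisorLefschetzGroup`** —
  `c ∈ 𝒟ᵖ ⊗ ℂ ⟺ ⋀^{2p}u c = c` for every `u ∈ G_div(X)(ℂ)` («⟹» `DivisorLefschetzGroup`; «⟸» through `S(A)(h)(ℂ) ≤ G_div`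
  and Milne's theorem), with the subspace form `le_divisorClassesSpan_iff_forall_mem_divisorLefschetzGroup`.
* §2 «`W_F` CONSISTS OF DECOMPOSABLE CLASSES ⟺ `G_div(X)` ACTS AS THE IDENTITY ON `W_F`»:
  **`weilClassesField_le_divisorClassesSpan_iff_forall_mem_divisorLefschetzGroup`** (no hypothesis on `P`, `φ`).
* §3 «… ⟺ `G_div(X) ⊆ Sl_F(V_X)`»: **`weilClassesField_le_divisorClassesSpan_iff_divisorLefschetzGroup_le_slF`** —
  `W_F ⊗ ℂ ≤ 𝒟ᵐ ⊗ ℂ` iff every `u ∈ G_div(X)(ℂ)` commutes with `φ^*` AND has `det(u | V_ρ) = 1` at every complex root `ρ` of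
  `P` (Lemma (2) for the multiplicative pair `(u, ⋀^{2m}u)`, the tree's `forall_apply_eq_of_mem_weilClassesField_iff`).
  In particular «in the “only if” direction … Lemmas (2) and (3)»: **`comm_pullbackOne_of_mem_divisorLefschetzGroup_of_le`**
  — if `W_F` is decomposable then `G_div(X)(ℂ) ⊆ Gl_F(V_X)(ℂ)`, i.e. `F ⊆ End(V_X)^{G_div(X)}` (the carrier shadow of
  «`F ⊆ B`»); contrapositively **`weilClassesField_inf_divisorClassesSpan_eq_bot_of_not_comm`** — ONE `u ∈ G_div(X)(ℂ)` not
  commuting with `φ^*` makes every non-zero class of `W_F` exceptional (`m ≠ 0`; all-or-nothing) — the mechanism of the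
  Criterion's cases «Type 3, `m = 1`, `F ⊄ E`» and «Type 4, `d = m = 1`, `F ⊄ E₀`», where `F ⊄ B`.
* §4 «Conversely, suppose that `F ⊆ B`, so that `G_div(X) ⊆ Gl_F(V_X)`»: if `φ^* ∈ B ⊗ ℂ = Algebra.adjoin ℂ (S_λ ⊗ ℂ)`
  then `G_div(X)(ℂ)` commutes with `φ^*` (`DivisorLefschetzGroup`) and decomposability is `det(u | V_ρ) = 1` alone:
  **`weilClassesField_le_divisorClassesSpan_iff_forall_detOnEigenspace_eq_one_of_mem_adjoin`**. (The print's last step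
  «connected and semi-simple ⟹ `⊆ Sl_F`» is about algebraic groups and is NOT formalised.)
* §5 THE EXCEPTIONAL ALTERNATIVE: **`weilClassesField_inf_divisorClassesSpan_eq_bot_iff_exists_mem_divisorLefschetzGroup`**
  (`m ≠ 0`) — `W_F ⊗ ℂ ⊓ 𝒟ᵐ ⊗ ℂ = ⊥` iff some `u ∈ G_div(X)(ℂ)` lies outside `Sl_F(V_X)(ℂ)` (does not commute with `φ^*`, or
  has `det(u | V_ρ) ≠ 1` at some root).

Honesty clause: equivalences and mechanisms; no element of `G_div(X)(ℂ)` outside `Sl_F` is exhibited for any particular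
`A`, no Weil class is proved decomposable or exceptional outright, and `G_div(X)` is the group of `ℂ`-points on the
carrier (no algebraic group, no connectedness).

## References

* [MoonenZarhin1998WeilClasses] B. J. J. Moonen, Yu. G. Zarhin, J. reine angew. Math. 496 (1998) =
  arXiv:alg-geom/9612017, §1 Lemma (2)–(3) (chunk p0003 L4–L45), proof of Criterion (2) (chunk p0003 L62–L70),
  definition of `G_div(X)` (chunk p0002 L64–L76).
* [Milne1999LefschetzClasses] J. S. Milne, Duke Math. J. 96 (1999), §1 p. 644 (`S(A)`), Thm. 3.2 and Prop. 3.3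
  (p. 653), Thm. 4.4 and Cor. 4.5 (p. 659).
* [vanGeemen1994HodgeAV] B. van Geemen, LNM 1594 (1994), 2.4–2.5 (exceptional classes), 6.9–6.10 (`det(B ± √-d C)`).

## Provenance

Lane `lit-hodgefound` (Track 2, Layer A), prover seat `lit-hodgefound-p21` (generation 14), row g14-#3: the scope
caveat «`G_div` read as Milne's `S(A)(h)(ℂ)`» of Q1913 (`WeilClassesFieldDecomposableIffLefschetzGroup`) removed — the
same statements for the print's own `G_div(X)`.
-/

noncomputable section

open CategoryTheory Polynomial Module

namespace Literature.AlgebraicGeometry.HodgeTheory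

open Literature.AlgebraicGeometry.Motives
open Literature.AlgebraicGeometry.VanGeemen1994 (hodgeClassSpan pullbackOne detOnEigenspace)
open Literature.AlgebraicGeometry.Milne1999 (unitaryCentralizerGroup
  mem_divisorClassesSpan_of_forall_mem_unitaryCentralizerGroup)
open Literature.AlgebraicTopology.SingularHomology
open Literature.Barriers.HodgeConjecture (divisorClassesSpan)

section HodgeTheory

variable {A : AbelianVariety ℂ} {φ : A ⟶ A} {P : Polynomial ℤ} {e m : ℕ} {h : complexBetti A.X 2}

/-! ### §1 Lemma (3), third clause, for the print's `G_div(X)`: the `G_div(X)(ℂ)`-invariants of `H^{2p}` are `𝒟ᵖ ⊗ ℂ` -/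

section LemmaThree

/-- **MOONEN–ZARHIN, LEMMA (3), THIRD CLAUSE — «`(⊕ᵢ ⋀ⁱ V_X)^{G_div(X)} = 𝒟•(X)`» — PROVED on the carrier in every even
degree, for the print's own `G_div(X) = Gl_B(V) ∩ Sp(V, φ)`**: for `h ∈ B¹(A) ⊗ ℂ` with `Q_h` non-degenerate on
`H¹(A(ℂ); ℂ)` and `c ∈ H^{2p}(A(ℂ); ℂ)`: `c ∈ 𝒟ᵖ ⊗ ℂ = divisorClassesSpan A.X (dim A) p` iff `⋀^{2p}u c = c` for every
`u ∈ G_div(X)(ℂ) = divisorLefschetzGroup A h`. «⟹»: `DivisorLefschetzGroup`'s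
`exteriorPullback_eq_self_of_mem_divisorClassesSpan_of_mem_divisorLefschetzGroup`; «⟸»: `S(A)(h)(ℂ) ≤ G_div(X)(ℂ)` and
Milne's Thm. 3.2 / Cor. 4.5 over `ℂ` (the tree's `Milne1999.mem_divisorClassesSpan_of_forall_mem_unitaryCentralizerGroup`).
(Odd degrees carry no non-zero invariants: `DivisorLefschetzGroupLargest`.)
[cite: MoonenZarhin1998WeilClasses, §1 Lemma (3) (chunk p0003 L4–L5)]
[cite: Milne1999LefschetzClasses, Thm. 3.2 (p. 653), Thm. 4.4 and Cor. 4.5 (p. 659)] -/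
theorem mem_divisorClassesSpan_iff_forall_mem_divisorLefschetzGroup (hh : h ∈ hodgeClassSpan A.dim A.X 1)
    (hnd : ∀ x : complexBetti A.X 1, (∀ y, polarizationPairingOne A.X h (A.dim - 1) x y = 0) → x = 0)
    (p : ℕ) (c : complexBetti A.X (2 * p)) :
    c ∈ divisorClassesSpan A.X A.dim p ↔
      ∀ u ∈ divisorLefschetzGroup A h, exteriorPullback (AbelianVariety.hasExteriorCohomologyH1_complexPoints A)
        (u : complexBetti A.X 1 →ₗ[ℂ] complexBetti A.X 1) (2 * p) c = c :=
  ⟨fun hc _ hu ↦ exteriorPullback_eq_self_of_mem_divisorClassesSpan_of_mem_divisorLefschetzGroup hh hnd hu p hc,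
    fun hfix ↦ mem_divisorClassesSpan_of_forall_mem_unitaryCentralizerGroup A hh hnd p c fun u hu ↦
      hfix u (unitaryCentralizerGroup_le_divisorLefschetzGroup hu)⟩

/-- **Subspace form**: a complex subspace `M ⊆ H^{2p}(A(ℂ); ℂ)` lies in `𝒟ᵖ ⊗ ℂ` iff `G_div(X)(ℂ)` acts as the identity
on it. [cite: MoonenZarhin1998WeilClasses, §1 Lemma (3) (chunk p0003 L4–L5)] [cite: Milne1999LefschetzClasses, Thm. 3.2, Thm. 4.4, Cor. 4.5] -/
theorem le_divisorClassesSpan_iff_forall_mem_divisorLefschetzGroup (hh : h ∈ hodgeClassSpan A.dim A.X 1)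
    (hnd : ∀ x : complexBetti A.X 1, (∀ y, polarizationPairingOne A.X h (A.dim - 1) x y = 0) → x = 0)
    (p : ℕ) (M : Submodule ℂ (complexBetti A.X (2 * p))) :
    M ≤ divisorClassesSpan A.X A.dim p ↔
      ∀ u ∈ divisorLefschetzGroup A h, ∀ c ∈ M,
        exteriorPullback (AbelianVariety.hasExteriorCohomologyH1_complexPoints A)
          (u : complexBetti A.X 1 →ₗ[ℂ] complexBetti A.X 1) (2 * p) c = c :=
  ⟨fun hM u hu c hc ↦ (mem_divisorClassesSpan_iff_forall_mem_divisorLefschetzGroup hh hnd p c).1 (hM hc) u hu,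
    fun hfix c hc ↦ (mem_divisorClassesSpan_iff_forall_mem_divisorLefschetzGroup hh hnd p c).2 fun u hu ↦ hfix u hu c hc⟩

/-- **The invariants of `G_div(X)(ℂ)` and of Milne's `S(A)(h)(ℂ)` on `H^{2p}(A(ℂ); ℂ)` coincide** (both are `𝒟ᵖ ⊗ ℂ`),
although `S(A)(h)(ℂ) ≤ G_div(X)(ℂ)` may be a proper subgroup. [cite: MoonenZarhin1998WeilClasses, §1 Lemma (3) (chunk p0003 L4–L5)]
[cite: Milne1999LefschetzClasses, Thm. 3.2, Cor. 4.5] -/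
theorem forall_mem_divisorLefschetzGroup_iff_forall_mem_unitaryCentralizerGroup (hh : h ∈ hodgeClassSpan A.dim A.X 1)
    (hnd : ∀ x : complexBetti A.X 1, (∀ y, polarizationPairingOne A.X h (A.dim - 1) x y = 0) → x = 0)
    (p : ℕ) (c : complexBetti A.X (2 * p)) :
    (∀ u ∈ divisorLefschetzGroup A h, exteriorPullback (AbelianVariety.hasExteriorCohomologyH1_complexPoints A)
        (u : complexBetti A.X 1 →ₗ[ℂ] complexBetti A.X 1) (2 * p) c = c) ↔
      ∀ u ∈ unitaryCentralizerGroup A h, exteriorPullback (AbelianVariety.hasExteriorCohomologyH1_complexPoints A)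
        (u : complexBetti A.X 1 →ₗ[ℂ] complexBetti A.X 1) (2 * p) c = c := by
  rw [← mem_divisorClassesSpan_iff_forall_mem_divisorLefschetzGroup hh hnd,
    mem_divisorClassesSpan_iff_forall_unitaryCentralizerGroup_exteriorPullback_eq hh hnd]

end LemmaThree

/-! ### §2 «`W_F` consists of decomposable classes ⟺ `G_div(X)` acts as the identity on `W_F`» -/

section Mechanism

/-- **«`W_F` consists of decomposable classes ⟺ `G_div(X)` acts as the identity on `W_F`», PROVED on the carriers for
the print's `G_div(X)`** (any `h ∈ B¹(A) ⊗ ℂ` with `Q_h` non-degenerate; no hypothesis on `P`, `φ`):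
`W_F ⊗ ℂ ≤ 𝒟ᵐ ⊗ ℂ` iff every `⋀^{2m}u`, `u ∈ divisorLefschetzGroup A h`, fixes `W_F ⊗ ℂ` pointwise.
[cite: MoonenZarhin1998WeilClasses, §1 Lemma (3) and proof of Criterion (2) (chunk p0003 L62–L70)]
[cite: Milne1999LefschetzClasses, Thm. 3.2, Thm. 4.4, Cor. 4.5 (p. 659)] -/
theorem weilClassesField_le_divisorClassesSpan_iff_forall_mem_divisorLefschetzGroup
    (hh : h ∈ hodgeClassSpan A.dim A.X 1)
    (hnd : ∀ x : complexBetti A.X 1, (∀ y, polarizationPairingOne A.X h (A.dim - 1) x y = 0) → x = 0) :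
    weilClassesField A φ P (2 * m) ≤ divisorClassesSpan A.X A.dim m ↔
      ∀ u ∈ divisorLefschetzGroup A h, ∀ c ∈ weilClassesField A φ P (2 * m),
        exteriorPullback (AbelianVariety.hasExteriorCohomologyH1_complexPoints A)
          (u : complexBetti A.X 1 →ₗ[ℂ] complexBetti A.X 1) (2 * m) c = c :=
  le_divisorClassesSpan_iff_forall_mem_divisorLefschetzGroup hh hnd m _

/-! ### §3 «… ⟺ `G_div(X) ⊆ Sl_F(V_X)`» (Lemma (2)), and «in the “only if” direction … `G_div(X) ⊆ Gl_F(V_X)`» -/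

/-- **THE MECHANISM OF CRITERION (2) FOR THE PRINT'S `G_div(X)`: «`W_F` decomposable ⟺ `G_div(X) ⊆ Sl_F(V_X)`»** —
for `P ∈ ℤ[T]` monic irreducible of degree `e`, `P(φ) = 0`, `e · 2m = 2 dim A` and `h ∈ B¹(A) ⊗ ℂ` with `Q_h`
non-degenerate: `W_F ⊗ ℂ ≤ 𝒟ᵐ ⊗ ℂ` iff every `u ∈ G_div(X)(ℂ)` is `F`-linear (`u ∘ φ^* = φ^* ∘ u`) with `det(u | V_ρ) = 1`
at every complex root `ρ` of `P` (§2 and Lemma (2) for the multiplicative pair `(u, ⋀^{2m}u)`, the tree's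
`forall_apply_eq_of_mem_weilClassesField_iff`). Unlike Milne's `S(A)(h)(ℂ)`, the group `G_div(X)(ℂ)` centralizes only
`B ⊗ ℂ`, so the `F`-linearity is part of the condition.
[cite: MoonenZarhin1998WeilClasses, §1 Lemma (2)–(3) and proof of Criterion (2) (chunk p0003 L12–L70)]
[cite: Milne1999LefschetzClasses, Thm. 3.2, Thm. 4.4, Cor. 4.5 (p. 659)] -/
theorem weilClassesField_le_divisorClassesSpan_iff_divisorLefschetzGroup_le_slF
    (hPm : P.Monic) (hPe : P.natDegree = e) (hPirr : Irreducible (P.map (Int.castRingHom ℚ)))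
    (hφ : Polynomial.eval₂ (Int.castRingHom (CategoryTheory.End A)) (φ : CategoryTheory.End A) P = 0)
    (her : e * (2 * m) = 2 * A.dim) (hh : h ∈ hodgeClassSpan A.dim A.X 1)
    (hnd : ∀ x : complexBetti A.X 1, (∀ y, polarizationPairingOne A.X h (A.dim - 1) x y = 0) → x = 0) :
    weilClassesField A φ P (2 * m) ≤ divisorClassesSpan A.X A.dim m ↔
      ∀ u ∈ divisorLefschetzGroup A h, ∃ hc : ∀ x, u (pullbackOne A φ x) = pullbackOne A φ (u x),
        ∀ ρ : ℂ, Polynomial.eval₂ (Int.castRingHom ℂ) ρ P = 0 → detOnEigenspace u (pullbackOne A φ) hc ρ = 1 := by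
  rw [weilClassesField_le_divisorClassesSpan_iff_forall_mem_divisorLefschetzGroup hh hnd]
  exact forall₂_congr fun u _ ↦
    forall_apply_eq_of_mem_weilClassesField_iff hPm hPe hPirr hφ her (exteriorPullback_cupPowOne_abelianVariety u _)

/-- **«In the “only if” direction, this follows from Lemmas (2) and (3)»: `W_F` decomposable ⟹ `G_div(X) ⊆ Gl_F(V_X)`**,
i.e. every `u ∈ G_div(X)(ℂ)` commutes with `φ^*` — `F ⊆ End(V_X)^{G_div(X)}`, the carrier shadow of «`F ⊆ B`»
(`P` monic irreducible of degree `e`, `P(φ) = 0`, `e · 2m = 2 dim A`; `h ∈ B¹(A) ⊗ ℂ` with `Q_h` non-degenerate).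
[cite: MoonenZarhin1998WeilClasses, §1 proof of Criterion (2) (chunk p0003 L62–L66) with Lemma (2)–(3)] -/
theorem comm_pullbackOne_of_mem_divisorLefschetzGroup_of_le
    (hPm : P.Monic) (hPe : P.natDegree = e) (hPirr : Irreducible (P.map (Int.castRingHom ℚ)))
    (hφ : Polynomial.eval₂ (Int.castRingHom (CategoryTheory.End A)) (φ : CategoryTheory.End A) P = 0)
    (her : e * (2 * m) = 2 * A.dim) (hh : h ∈ hodgeClassSpan A.dim A.X 1)
    (hnd : ∀ x : complexBetti A.X 1, (∀ y, polarizationPairingOne A.X h (A.dim - 1) x y = 0) → x = 0)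
    (hW : weilClassesField A φ P (2 * m) ≤ divisorClassesSpan A.X A.dim m)
    {u : complexBetti A.X 1 ≃ₗ[ℂ] complexBetti A.X 1} (hu : u ∈ divisorLefschetzGroup A h) (x : complexBetti A.X 1) :
    u (pullbackOne A φ x) = pullbackOne A φ (u x) := by
  obtain ⟨hc, -⟩ := (weilClassesField_le_divisorClassesSpan_iff_divisorLefschetzGroup_le_slF hPm hPe hPirr hφ her hh
    hnd).1 hW u hu
  exact hc x

/-- **`W_F` decomposable ⟹ `det(u | V_ρ) = 1` for every `u ∈ G_div(X)(ℂ)` and every complex root `ρ`** (Lemma (2),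
second half, for the print's group). [cite: MoonenZarhin1998WeilClasses, §1 Lemma (2) and proof of Criterion (2) (chunk p0003 L12–L70)] -/
theorem detOnEigenspace_eq_one_of_mem_divisorLefschetzGroup_of_le
    (hPm : P.Monic) (hPe : P.natDegree = e) (hPirr : Irreducible (P.map (Int.castRingHom ℚ)))
    (hφ : Polynomial.eval₂ (Int.castRingHom (CategoryTheory.End A)) (φ : CategoryTheory.End A) P = 0)
    (her : e * (2 * m) = 2 * A.dim) (hh : h ∈ hodgeClassSpan A.dim A.X 1)
    (hnd : ∀ x : complexBetti A.X 1, (∀ y, polarizationPairingOne A.X h (A.dim - 1) x y = 0) → x = 0)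
    (hW : weilClassesField A φ P (2 * m) ≤ divisorClassesSpan A.X A.dim m)
    {u : complexBetti A.X 1 ≃ₗ[ℂ] complexBetti A.X 1} (hu : u ∈ divisorLefschetzGroup A h) {ρ : ℂ}
    (hρ : Polynomial.eval₂ (Int.castRingHom ℂ) ρ P = 0) :
    detOnEigenspace u (pullbackOne A φ)
        (comm_pullbackOne_of_mem_divisorLefschetzGroup_of_le hPm hPe hPirr hφ her hh hnd hW hu) ρ = 1 := by
  obtain ⟨hc, hdet⟩ := (weilClassesField_le_divisorClassesSpan_iff_divisorLefschetzGroup_le_slF hPm hPe hPirr hφ her hh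
    hnd).1 hW u hu
  exact hdet ρ hρ

/-- **ONE `u ∈ G_div(X)(ℂ)` NOT COMMUTING WITH `φ^*` MAKES ALL NON-ZERO WEIL CLASSES OF `F = ℚ(φ)` EXCEPTIONAL** (`m ≠ 0`;
`P` monic irreducible of degree `e`, `P(φ) = 0`, `e · 2m = 2 dim A`; `h ∈ B¹(A) ⊗ ℂ` with `Q_h` non-degenerate): then
`W_F ⊗ ℂ ⊓ 𝒟ᵐ ⊗ ℂ = ⊥` (contrapositive of the previous theorem with the all-or-nothing alternative, the tree's
`weilClassesField_inf_divisorClassesSpan_eq_bot_or_le`). This is the mechanism behind the Criterion's cases «Type 3,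
`m = 1` and `F ⊄ E`» and «Type 4, `d = 1`, `m = 1` and `F ⊄ E₀`», where `F ⊄ B`.
[cite: MoonenZarhin1998WeilClasses, §1 Criterion (2) and its proof (chunk p0003 L46–L70)] -/
theorem weilClassesField_inf_divisorClassesSpan_eq_bot_of_not_comm
    (hPm : P.Monic) (hPe : P.natDegree = e) (hPirr : Irreducible (P.map (Int.castRingHom ℚ)))
    (hφ : Polynomial.eval₂ (Int.castRingHom (CategoryTheory.End A)) (φ : CategoryTheory.End A) P = 0)
    (her : e * (2 * m) = 2 * A.dim) (hm : m ≠ 0) (hh : h ∈ hodgeClassSpan A.dim A.X 1)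
    (hnd : ∀ x : complexBetti A.X 1, (∀ y, polarizationPairingOne A.X h (A.dim - 1) x y = 0) → x = 0)
    {u : complexBetti A.X 1 ≃ₗ[ℂ] complexBetti A.X 1} (hu : u ∈ divisorLefschetzGroup A h)
    (hnc : ∃ x, u (pullbackOne A φ x) ≠ pullbackOne A φ (u x)) :
    weilClassesField A φ P (2 * m) ⊓ divisorClassesSpan A.X A.dim m = ⊥ := by
  rcases weilClassesField_inf_divisorClassesSpan_eq_bot_or_le hPe hPirr hφ her hm with hbot | hle
  · exact hbot
  · obtain ⟨x, hx⟩ := hnc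
    exact absurd (comm_pullbackOne_of_mem_divisorLefschetzGroup_of_le hPm hPe hPirr hφ her hh hnd hle hu x) hx

/-! ### §4 «Conversely, suppose that `F ⊆ B`, so that `G_div(X) ⊆ Gl_F(V_X)`» -/

/-- **«Suppose that `F ⊆ B`, so that `G_div(X) ⊆ Gl_F(V_X)`»**: if `φ^*` lies in `B ⊗ ℂ = Algebra.adjoin ℂ (S_λ ⊗ ℂ)`,
every `u ∈ G_div(X)(ℂ)` commutes with `φ^*` (`DivisorLefschetzGroup.divisorLefschetzGroup_comm_of_mem_adjoin`).
[cite: MoonenZarhin1998WeilClasses, §1 proof of Criterion (2) (chunk p0003 L66–L68)] -/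
theorem comm_pullbackOne_of_mem_divisorLefschetzGroup_of_pullbackOne_mem_adjoin
    (hF : pullbackOne A φ ∈ Algebra.adjoin ℂ (symmetricPullbackSpan A h : Set (Module.End ℂ (complexBetti A.X 1))))
    {u : complexBetti A.X 1 ≃ₗ[ℂ] complexBetti A.X 1} (hu : u ∈ divisorLefschetzGroup A h) (x : complexBetti A.X 1) :
    u (pullbackOne A φ x) = pullbackOne A φ (u x) :=
  divisorLefschetzGroup_comm_of_mem_adjoin hu hF x

/-- **For `F ⊆ B`: «`W_F` decomposable ⟺ `det(u | V_ρ) = 1` for every `u ∈ G_div(X)(ℂ)` and every root `ρ`»** — with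
`φ^* ∈ B ⊗ ℂ` the `F`-linearity of `G_div(X)(ℂ)` is automatic and only the `Sl_F` condition remains (`P` monic irreducible
of degree `e`, `P(φ) = 0`, `e · 2m = 2 dim A`; `h ∈ B¹(A) ⊗ ℂ` with `Q_h` non-degenerate). (The print concludes
`G_div(X) ⊆ Sl_F(V_X)` in the cases «type 1, 2, type 3 with `m = 1`, type 4 with `d = m = 1`» from «connected and
semi-simple» — algebraic-group input that is not on the carrier.)
[cite: MoonenZarhin1998WeilClasses, §1 proof of Criterion (2) (chunk p0003 L62–L70)] -/
theorem weilClassesField_le_divisorClassesSpan_iff_forall_detOnEigenspace_eq_one_of_mem_adjoin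
    (hPm : P.Monic) (hPe : P.natDegree = e) (hPirr : Irreducible (P.map (Int.castRingHom ℚ)))
    (hφ : Polynomial.eval₂ (Int.castRingHom (CategoryTheory.End A)) (φ : CategoryTheory.End A) P = 0)
    (her : e * (2 * m) = 2 * A.dim) (hh : h ∈ hodgeClassSpan A.dim A.X 1)
    (hnd : ∀ x : complexBetti A.X 1, (∀ y, polarizationPairingOne A.X h (A.dim - 1) x y = 0) → x = 0)
    (hF : pullbackOne A φ ∈ Algebra.adjoin ℂ (symmetricPullbackSpan A h : Set (Module.End ℂ (complexBetti A.X 1)))) :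
    weilClassesField A φ P (2 * m) ≤ divisorClassesSpan A.X A.dim m ↔
      ∀ u (hu : u ∈ divisorLefschetzGroup A h) (ρ : ℂ), Polynomial.eval₂ (Int.castRingHom ℂ) ρ P = 0 →
        detOnEigenspace u (pullbackOne A φ)
          (comm_pullbackOne_of_mem_divisorLefschetzGroup_of_pullbackOne_mem_adjoin hF hu) ρ = 1 := by
  rw [weilClassesField_le_divisorClassesSpan_iff_divisorLefschetzGroup_le_slF hPm hPe hPirr hφ her hh hnd]
  refine ⟨fun H u hu ρ hρ ↦ ?_, fun H u hu ↦ ⟨_, H u hu⟩⟩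
  obtain ⟨hc, hdet⟩ := H u hu
  exact hdet ρ hρ

/-! ### §5 The exceptional alternative, read on `G_div(X)(ℂ)` -/

/-- **«All non-zero classes in `W_F` are exceptional» ⟺ SOME `u ∈ G_div(X)(ℂ)` LIES OUTSIDE `Sl_F(V_X)(ℂ)`** (`m ≠ 0`;
`P` monic irreducible of degree `e`, `P(φ) = 0`, `e · 2m = 2 dim A`; `h ∈ B¹(A) ⊗ ℂ` with `Q_h` non-degenerate):
`W_F ⊗ ℂ ⊓ 𝒟ᵐ ⊗ ℂ = ⊥` iff not every `u ∈ divisorLefschetzGroup A h` is `F`-linear with `det(u | V_ρ) = 1` at all roots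
(all-or-nothing: `W_F ⊗ ℂ` meets `𝒟ᵐ ⊗ ℂ` in `0` or lies inside it, the tree's `weilClassesField_inf_divisorClassesSpan_eq_bot_or_le`;
`W_F ⊗ ℂ ≠ 0`). [cite: MoonenZarhin1998WeilClasses, §1 Criterion (2) («or all non-zero classes in W_F are exceptional») and its proof (chunk p0003 L46–L70)]
[cite: Milne1999LefschetzClasses, Thm. 3.2, Cor. 4.5] -/
theorem weilClassesField_inf_divisorClassesSpan_eq_bot_iff_exists_mem_divisorLefschetzGroup
    (hPm : P.Monic) (hPe : P.natDegree = e) (hPirr : Irreducible (P.map (Int.castRingHom ℚ)))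
    (hφ : Polynomial.eval₂ (Int.castRingHom (CategoryTheory.End A)) (φ : CategoryTheory.End A) P = 0)
    (her : e * (2 * m) = 2 * A.dim) (hm : m ≠ 0) (hh : h ∈ hodgeClassSpan A.dim A.X 1)
    (hnd : ∀ x : complexBetti A.X 1, (∀ y, polarizationPairingOne A.X h (A.dim - 1) x y = 0) → x = 0) :
    weilClassesField A φ P (2 * m) ⊓ divisorClassesSpan A.X A.dim m = ⊥ ↔
      ∃ u ∈ divisorLefschetzGroup A h, ¬ ∃ hc : ∀ x, u (pullbackOne A φ x) = pullbackOne A φ (u x),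
        ∀ ρ : ℂ, Polynomial.eval₂ (Int.castRingHom ℂ) ρ P = 0 → detOnEigenspace u (pullbackOne A φ) hc ρ = 1 := by
  refine ⟨fun hbot ↦ ?_, fun ⟨u, hu, hnot⟩ ↦ ?_⟩
  · by_contra hne
    push Not at hne
    have hle : weilClassesField A φ P (2 * m) ≤ divisorClassesSpan A.X A.dim m :=
      (weilClassesField_le_divisorClassesSpan_iff_divisorLefschetzGroup_le_slF hPm hPe hPirr hφ her hh hnd).2 hne
    obtain ⟨γ, hγW, -, hγ0⟩ := exists_isRationalClass_ne_zero_mem_weilClassesField hPm hPe hPirr hφ her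
    have h0 : γ ∈ weilClassesField A φ P (2 * m) ⊓ divisorClassesSpan A.X A.dim m := ⟨hγW, hle hγW⟩
    rw [hbot, Submodule.mem_bot] at h0
    exact hγ0 h0
  · rcases weilClassesField_inf_divisorClassesSpan_eq_bot_or_le hPe hPirr hφ her hm with hbot | hle
    · exact hbot
    · exact absurd ((weilClassesField_le_divisorClassesSpan_iff_divisorLefschetzGroup_le_slF hPm hPe hPirr hφ her hh
        hnd).1 hle u hu) hnot

/-- **A single witness suffices**: `u ∈ G_div(X)(ℂ)` commuting with `φ^*` but with `det(u | V_ρ) ≠ 1` at some root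
makes every non-zero class of `W_F` exceptional (`m ≠ 0`) — the print's type-3, `m ≥ 2` mechanism («`g` … not in the
connected component … acts on `W_F ⊗ ℂ` as multiplication by `(-1)^{2m/[F:E]}`») abstracted.
[cite: MoonenZarhin1998WeilClasses, §1 proof of Criterion (2), type 3 with m ≥ 2 (chunk p0003 L71–L90)] -/
theorem weilClassesField_inf_divisorClassesSpan_eq_bot_of_mem_divisorLefschetzGroup_detOnEigenspace_ne_one
    (hPm : P.Monic) (hPe : P.natDegree = e) (hPirr : Irreducible (P.map (Int.castRingHom ℚ)))
    (hφ : Polynomial.eval₂ (Int.castRingHom (CategoryTheory.End A)) (φ : CategoryTheory.End A) P = 0)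
    (her : e * (2 * m) = 2 * A.dim) (hm : m ≠ 0) (hh : h ∈ hodgeClassSpan A.dim A.X 1)
    (hnd : ∀ x : complexBetti A.X 1, (∀ y, polarizationPairingOne A.X h (A.dim - 1) x y = 0) → x = 0)
    {u : complexBetti A.X 1 ≃ₗ[ℂ] complexBetti A.X 1} (hu : u ∈ divisorLefschetzGroup A h)
    (hc : ∀ x, u (pullbackOne A φ x) = pullbackOne A φ (u x)) {ρ : ℂ}
    (hρ : Polynomial.eval₂ (Int.castRingHom ℂ) ρ P = 0) (hdet : detOnEigenspace u (pullbackOne A φ) hc ρ ≠ 1) :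
    weilClassesField A φ P (2 * m) ⊓ divisorClassesSpan A.X A.dim m = ⊥ := by
  refine (weilClassesField_inf_divisorClassesSpan_eq_bot_iff_exists_mem_divisorLefschetzGroup hPm hPe hPirr hφ her hm
    hh hnd).2 ⟨u, hu, fun ⟨hc', hdet'⟩ ↦ hdet ?_⟩
  rw [VanGeemen1994.detOnEigenspace_congr rfl hc hc' ρ]
  exact hdet' ρ hρ

end Mechanism

end HodgeTheory

end Literature.AlgebraicGeometry.HodgeTheory

end
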